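import Literature.Analysis.FluidPDE.SereginSverakPressureProofs
import Literature.Analysis.FluidPDE.Seregin2020ScaledEnergyBounds
import Literature.Analysis.FluidPDE.CKN1982Setting

/-!
# Crux `SelfMixingDichotomy.SequentialTypeIExclusion` (stmt-NavierStokesRegularity-1424), line
  `registered`: work file for the STUB `stub_windowsForceTypeI` (no scale-intermittency)

The registered stub asks: for a classical Leray–Hopf solution `u` (`ν = 1`) on `ℝ³ × [0, T)` from a
rapidly decaying datum and a point `x₀`, Type-I windows at arbitrarily small scales
(`∀ r₀ > 0 ∃ r ∈ (0, r₀), C(r; T, x₀) ≤ M`, `C = cknC`, backward cylinders `Q_r(T, x₀)`) force a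
centred cubic Type-I bound `C(r; T, x₀) ≤ M'` for all `0 < r < r₁`.

This is OPEN (no literature controls `C` from above between sparse windows). The only
scale-free upward control available is the monotonicity `C(ρ) ≤ (r/ρ)² C(r)` for `ρ ≤ r`
(`Seregin2020.cknC_le_mul_of_subset` + `parabolicCylinder_mono`). This file machine-checks what
that monotonicity gives:

* `cknC_typeI_of_logDenseWindows`: LOG-DENSE windows (every `ρ ∈ (0, r₁)` has a window scale
  `r ∈ [ρ, K ρ]`) force the Type-I bound `C(ρ) ≤ K² M` on `(0, r₁)`;
* `cknC_typeI_of_logDenseSeq`: the same for windows along a sequence `r_k → 0` with bounded gaps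
  `r_k ≤ K r_{k+1}`;
* `windowsForceTypeI_of_nonpos`: the degenerate corner `M ≤ 0` of the stub (a window of depth
  `ofReal M = 0` kills `C` at all smaller scales).

So the open content of the stub is exactly the case of SPARSE windows (`r_k / r_{k+1} → ∞`).
-/

noncomputable section

-- the summit and its single problem share the name (D-0017 nested layout)
set_option linter.dupNamespace false

namespace Summit.NavierStokesRegularity.NavierStokesRegularity.Theorems.SequentialTypeIExclusion.Registered

open scoped ENNReal NNReal Topology
open Literature.Analysis.FluidPDE Set Filter MeasureTheory Function Metric

/-- **Monotonicity of the cubic functional, real-ratio form.** For `0 < ρ ≤ r`,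
`C(ρ; z) ≤ (r/ρ)² C(r; z)` (`Q_ρ(z) ⊆ Q_r(z)` and `ρ⁻² = (r/ρ)² r⁻²`). -/
theorem cknC_le_mul_of_le {ρ r : ℝ} (hρ : 0 < ρ) (hρr : ρ ≤ r) (z : ℝ × EuclideanSpace ℝ (Fin 3))
    (u : ℝ → EuclideanSpace ℝ (Fin 3) → EuclideanSpace ℝ (Fin 3)) :
    cknC ρ z u ≤ ENNReal.ofReal (r / ρ) ^ 2 * cknC r z u :=
  Seregin2020.cknC_le_mul_of_subset (hρ.trans_le hρr) hρ (parabolicCylinder_mono hρ.le hρr z) u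

/-- **A window at scale `r ∈ [ρ, K ρ]` bounds `C(ρ)` by `K² M`.** -/
theorem cknC_le_of_window {ρ r K M : ℝ} (hρ : 0 < ρ) (hρr : ρ ≤ r) (hrK : r ≤ K * ρ)
    (z : ℝ × EuclideanSpace ℝ (Fin 3))
    (u : ℝ → EuclideanSpace ℝ (Fin 3) → EuclideanSpace ℝ (Fin 3))
    (hC : cknC r z u ≤ ENNReal.ofReal M) :
    cknC ρ z u ≤ ENNReal.ofReal (K ^ 2 * M) := by
  have hK : 0 ≤ K := by
    by_contra h
    have : K * ρ < 0 := mul_neg_of_neg_of_pos (lt_of_not_ge h) hρ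
    linarith
  calc cknC ρ z u ≤ ENNReal.ofReal (r / ρ) ^ 2 * cknC r z u := cknC_le_mul_of_le hρ hρr z u
    _ ≤ ENNReal.ofReal K ^ 2 * ENNReal.ofReal M := by
        gcongr
        exact (div_le_iff₀ hρ).2 hrK
    _ = ENNReal.ofReal (K ^ 2 * M) := by
        rw [← ENNReal.ofReal_pow hK, ENNReal.ofReal_mul (pow_nonneg hK 2)]

/-- **LOG-DENSE Type-I windows force a centred cubic Type-I bound** (monotonicity only; this is
the provable special case of the registered stub `stub_windowsForceTypeI`, whose open content is
therefore the case of SPARSE windows). For any field `u`, point `x₀`, final time `T` and reals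
`M`, `K`, `r₁`: if every scale `ρ ∈ (0, r₁)` has a window scale `r` with `ρ ≤ r ≤ K ρ` and
`C(r; T, x₀) ≤ M`, then `C(ρ; T, x₀) ≤ K² M` for every `ρ ∈ (0, r₁)`. (No sign hypothesis on `M`
and no `K ≥ 1`, `r₁ > 0` are needed: they are forced whenever the hypothesis is non-vacuous.) -/
theorem cknC_typeI_of_logDenseWindows
    (u : ℝ → EuclideanSpace ℝ (Fin 3) → EuclideanSpace ℝ (Fin 3))
    (x₀ : EuclideanSpace ℝ (Fin 3)) (T M K r₁ : ℝ)
    (hwin : ∀ ρ ∈ Set.Ioo 0 r₁, ∃ r : ℝ, ρ ≤ r ∧ r ≤ K * ρ ∧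
      cknC r ((T, x₀) : ℝ × EuclideanSpace ℝ (Fin 3)) u ≤ ENNReal.ofReal M) :
    ∀ ρ ∈ Set.Ioo 0 r₁,
      cknC ρ ((T, x₀) : ℝ × EuclideanSpace ℝ (Fin 3)) u ≤ ENNReal.ofReal (K ^ 2 * M) := by
  intro ρ hρ
  obtain ⟨r, hρr, hrK, hC⟩ := hwin ρ hρ
  exact cknC_le_of_window hρ.1 hρr hrK _ u hC

/-- **Sequential form.** If `C(r_k; T, x₀) ≤ M` along a sequence of positive scales `r_k → 0` with
bounded gaps `r_k ≤ K r_{k+1}` (log-dense; monotonicity of `r` is not needed), then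
`C(ρ; T, x₀) ≤ K² M` for every `0 < ρ < r_0`. -/
theorem cknC_typeI_of_logDenseSeq
    (u : ℝ → EuclideanSpace ℝ (Fin 3) → EuclideanSpace ℝ (Fin 3))
    (x₀ : EuclideanSpace ℝ (Fin 3)) (T M K : ℝ) (r : ℕ → ℝ) (hpos : ∀ k, 0 < r k)
    (hgap : ∀ k, r k ≤ K * r (k + 1))
    (hlim : Tendsto r atTop (𝓝 0))
    (hwin : ∀ k, cknC (r k) ((T, x₀) : ℝ × EuclideanSpace ℝ (Fin 3)) u ≤ ENNReal.ofReal M) :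
    ∀ ρ ∈ Set.Ioo 0 (r 0),
      cknC ρ ((T, x₀) : ℝ × EuclideanSpace ℝ (Fin 3)) u ≤ ENNReal.ofReal (K ^ 2 * M) := by
  refine cknC_typeI_of_logDenseWindows u x₀ T M K (r 0) fun ρ hρ => ?_
  -- the last index `k` with `ρ ≤ r k`: it exists since `ρ ≤ r 0`, and is bounded since `r_k → 0`
  have hex : ∃ k, r k < ρ := by
    have := (hlim.eventually (gt_mem_nhds hρ.1)).exists
    exact this
  classical
  -- `N` = first index with `r N < ρ`; `N ≠ 0` because `ρ < r 0`
  let N := Nat.find hex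
  have hN : r N < ρ := Nat.find_spec hex
  have hN0 : N ≠ 0 := by
    intro h
    have : r 0 < ρ := by simpa [N, h] using hN
    linarith [hρ.2]
  obtain ⟨k, hk⟩ := Nat.exists_eq_succ_of_ne_zero hN0
  have hkρ : ρ ≤ r k := by
    have := Nat.find_min hex (show k < N by omega)
    exact le_of_not_gt this
  refine ⟨r k, hkρ, ?_, hwin k⟩
  calc r k ≤ K * r (k + 1) := hgap k
    _ = K * r N := by rw [hk]
    _ ≤ K * ρ := by
        have hK : 0 ≤ K := by
          by_contra h
          have h1 : K * r (k + 1) < 0 := mul_neg_of_neg_of_pos (lt_of_not_ge h) (hpos _)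
          linarith [hgap k, hpos k]
        exact mul_le_mul_of_nonneg_left hN.le hK

/-- **The degenerate corner `M ≤ 0` of the registered stub** (exact stub shape plus `M ≤ 0`): a
window `C(r) ≤ ofReal M = 0` makes `u = 0` a.e. on `Q_r(T, x₀)`, hence `C(ρ) = 0` for all
`0 < ρ < r`. -/
theorem windowsForceTypeI_of_nonpos (M : ℝ) (hM : M ≤ 0) (T : ℝ)
    (u : ℝ → EuclideanSpace ℝ (Fin 3) → EuclideanSpace ℝ (Fin 3)) (x₀ : EuclideanSpace ℝ (Fin 3))
    (hwin : ∀ r₀ : ℝ, 0 < r₀ → ∃ r ∈ Set.Ioo 0 r₀,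
      cknC r ((T, x₀) : ℝ × EuclideanSpace ℝ (Fin 3)) u ≤ ENNReal.ofReal M) :
    ∃ M' : ℝ, ∃ r₁ : ℝ, 0 < r₁ ∧ ∀ r ∈ Set.Ioo 0 r₁,
      cknC r ((T, x₀) : ℝ × EuclideanSpace ℝ (Fin 3)) u ≤ ENNReal.ofReal M' := by
  obtain ⟨r, hr, hC⟩ := hwin 1 one_pos
  refine ⟨0, r, hr.1, fun ρ hρ => ?_⟩
  rw [ENNReal.ofReal_of_nonpos hM] at hC
  calc cknC ρ (T, x₀) u ≤ ENNReal.ofReal (r / ρ) ^ 2 * cknC r (T, x₀) u :=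
        cknC_le_mul_of_le hρ.1 hρ.2.le _ u
    _ = 0 := by rw [nonpos_iff_eq_zero.1 hC, mul_zero]
    _ ≤ ENNReal.ofReal 0 := zero_le

end Summit.NavierStokesRegularity.NavierStokesRegularity.Theorems.SequentialTypeIExclusion.Registered
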